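import Mathlib
import Summits.ResolutionOfSingularities.ResolutionOfSingularities.Theorems.RadicialJungCleanModelsGenericSpreadSimple
import Summits.ResolutionOfSingularities.ResolutionOfSingularities.Theorems.RadicialJungCleanModelsGenericSpreadTypeTwo
import HarnessLib

/-!
# Route `RadicialJung`, crux `CleanModels` (stmt-ResolutionOfSingularities-15917), line `Sketch` rev 35, stub 6 `stub_cleanProp44` (X44c),
# work plan O8 / L7b-global, item (G1) assembled at RING LEVEL: clean-regular at the generic point of the curve ⟹ off one divisor, every point of
# the curve is clean-permissible or deficient

Memo `Cruxes/CleanModels/Lines/Sketch-memo-hand2-g9-stubs-5-7.md` §3a.  `A` a domain (affine coordinate ring of the stage), `𝔭` the prime of the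
curve, `B = A_𝔭` (`dim B = 2`) with `K = Frac A`, `q₀, q₁ ∈ A` generating `𝔪_B`.  If the line of `G` is clean-regular at `B`, there is ONE
`g ∉ 𝔭` such that at every prime `𝔮 ⊇ 𝔭`, `g ∉ 𝔮`, with `A_𝔮` regular and `(q₀, q₁)` a regular pair generating `𝔭A_𝔮`: EITHER the line is
clean-permissible for `𝔭A_𝔮`, OR (only possible for the clean type (2) at `B`) the line has a UNIT representative `w ∈ A_𝔮` with
`w ≡ c^p (mod 𝔭A_𝔮 + 𝔪²)` — the deficiency condition (`exists_not_mem_forall_cleanPermissibleAt_or_deficient_of_cleanRegAt_generic`).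
Cases: type (1) two factors ✓ `…_of_generic_pair` (p816750); type (1) one factor and type (3) (after the shift ✓ `rep_shift_sub_pow`)
✓ `…_of_generic_simple` (p816835); type (2) ✓ `exists_rep_…_of_generic_unit` (`…GenericSpreadTypeTwo.lean`).

Honest framing: OURS (bookkeeping); the scheme reading and the finiteness of the deficient points are left (memo §3a); nothing here proves X44c or
any case of `CleanModels`.
-/

noncomputable section

set_option linter.dupNamespace false -- mandated namespace of this single-conjunct summit

open IsLocalRing Literature.AlgebraicGeometry.Resolution

namespace Summit.ResolutionOfSingularities.ResolutionOfSingularities.Theorems.RadicialJung.CleanModels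

/-- **(G1) at ring level.**  See the module docstring. [cite: CossartPiltant2008, Prop. 4.4 (proof, p. 10)] [cite: Piltant2013, §2 Axiom 4]
[cite: Matsumura1987, Thm. 14.2] -/
theorem exists_not_mem_forall_cleanPermissibleAt_or_deficient_of_cleanRegAt_generic {A K : Type} [CommRing A] [IsDomain A] [Field K]
    [Algebra A K] [IsFractionRing A K] (p : ℕ) [hp : Fact p.Prime] [CharP K p] (𝔭 : Ideal A) [h𝔭 : 𝔭.IsPrime]
    (B : Type) [CommRing B] [IsLocalRing B] [Algebra A B] [IsLocalization.AtPrime B 𝔭] [Algebra B K] [IsScalarTower A B K]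
    (q : Fin 2 → A) (hq : Ideal.map (algebraMap A B) (Ideal.span (Set.range q)) = maximalIdeal B) (hdimB : ringKrullDim B = 2)
    (G : K) (hG : CleanRegAt p (algebraMap B K) G) :
    ∃ g : A, g ∉ 𝔭 ∧ ∀ (𝔮 : Ideal A) [𝔮.IsPrime], g ∉ 𝔮 →
      ∀ (R : Type) [CommRing R] [IsRegularLocalRing R] [Algebra A R] [IsLocalization.AtPrime R 𝔮] [Algebra R K] [IsScalarTower A R K],
        IsRsopPart (fun j => algebraMap A R (q j)) → Ideal.span (Set.range fun j => algebraMap A R (q j)) = Ideal.map (algebraMap A R) 𝔭 →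
        (∃ cc' : Fin p → K, (∃ j : Fin p, (j : ℕ) ≠ 0 ∧ cc' j ≠ 0) ∧
            CleanPermissibleAt p (algebraMap R K) G (Ideal.map (algebraMap A R) 𝔭)) ∨
          ∃ (cc' : Fin p → K) (w c : R), (∃ j : Fin p, (j : ℕ) ≠ 0 ∧ cc' j ≠ 0) ∧ IsUnit w ∧
            (∑ j : Fin p, cc' j ^ p * G ^ (j : ℕ)) = algebraMap R K w ∧ w - c ^ p ∈ Ideal.map (algebraMap A R) 𝔭 ⊔ maximalIdeal R ^ 2 := by
  classical
  obtain ⟨hregB, cc, hcc, hform⟩ := hG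
  rcases hform with ⟨d, m, hmd, t, a, u, hu, hspan, hdim, hm, ha, hGX⟩ | ⟨u, hu, hGX, hup⟩ | ⟨s', c', hGX, hsc, hsc2⟩
  · -- type (1)
    have hd2 : d = 2 := by
      rw [hdim] at hdimB; exact_mod_cast hdimB
    subst hd2
    have hdB : (maximalIdeal B).spanFinrank = 2 := by
      have h := IsRegularLocalRing.spanFinrank_maximalIdeal (R := B)
      rw [hdim] at h
      exact_mod_cast h
    have htrsop : IsRsopPart (t ∘ Fin.castLE hmd) := isRsopPart_comp_of_rsop hdB t hspan (Fin.castLE hmd) (Fin.castLE_injective hmd)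
    obtain rfl | rfl : m = 1 ∨ m = 2 := by omega
    · -- one factor: the simple case
      have hX1 : (∑ j : Fin p, cc j ^ p * G ^ (j : ℕ)) = algebraMap B K (u * t (Fin.castLE hmd 0) ^ a 0) := by
        rw [hGX, Fin.prod_univ_one]
      obtain ⟨g, hg, hall⟩ := exists_not_mem_forall_cleanPermissibleAt_of_generic_simple p 𝔭 B q hq G cc hcc (t (Fin.castLE hmd 0))
        (by rw [← hspan]; exact Ideal.subset_span ⟨_, rfl⟩) (htrsop.not_mem_sq 0) (a 0) (ha 0) u hu hX1
      refine ⟨g, hg, fun 𝔮 _ hg𝔮 R _ _ _ _ _ _ hqr hqs => Or.inl (hall 𝔮 hg𝔮 R hqr hqs)⟩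
    · -- two factors: the pair case
      have htid : (fun i => t (Fin.castLE hmd i)) = t := funext fun i => congrArg t (Fin.ext rfl)
      have hX2 : (∑ j : Fin p, cc j ^ p * G ^ (j : ℕ)) = algebraMap B K (u * ∏ i, t i ^ a i) := by
        rw [hGX]; exact congrArg _ (congrArg (u * ·) (Finset.prod_congr rfl fun i _ => by rw [show Fin.castLE hmd i = i from Fin.ext rfl]))
      obtain ⟨g, hg, hall⟩ := exists_not_mem_forall_cleanPermissibleAt_of_generic_pair p 𝔭 B q hq G cc hcc t hspan a ha u hu hX2
      refine ⟨g, hg, fun 𝔮 _ hg𝔮 R _ _ _ _ _ _ hqr hqs => Or.inl (hall 𝔮 hg𝔮 R hqr hqs)⟩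
  · -- type (2): clean-permissible or deficient
    obtain ⟨g, v, cc', hg, hcc', hXv, hall⟩ :=
      exists_rep_not_mem_forall_cleanPermissibleAt_or_deficient_of_generic_unit p 𝔭 B G cc hcc u hu hGX
    refine ⟨g, hg, fun 𝔮 _ hg𝔮 R _ _ _ _ _ _ hqr hqs => ?_⟩
    obtain ⟨hvunit, hdich⟩ := hall 𝔮 hg𝔮 R q hqr hqs
    rcases hdich with hperm | ⟨c, hc⟩
    · exact Or.inl ⟨cc', hcc', hperm⟩
    · refine Or.inr ⟨cc', algebraMap A R v, c, hcc', hvunit, ?_, hc⟩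
      rw [hXv, IsScalarTower.algebraMap_apply A R K]
  · -- type (3): shift the representative and use the simple case with exponent one
    obtain ⟨cc₁, hcc₁, hX₁⟩ := rep_shift_sub_pow p (algebraMap B K) G cc hcc s' c' hGX
    have hX₁' : (∑ j : Fin p, cc₁ j ^ p * G ^ (j : ℕ)) = algebraMap B K (1 * (s' - c' ^ p) ^ 1) := by rw [hX₁, one_mul, pow_one]
    obtain ⟨g, hg, hall⟩ := exists_not_mem_forall_cleanPermissibleAt_of_generic_simple p 𝔭 B q hq G cc₁ hcc₁ (s' - c' ^ p) hsc hsc2 1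
      (fun h1 => hp.out.ne_one (Nat.dvd_one.mp h1)) 1 isUnit_one hX₁'
    refine ⟨g, hg, fun 𝔮 _ hg𝔮 R _ _ _ _ _ _ hqr hqs => Or.inl (hall 𝔮 hg𝔮 R hqr hqs)⟩

end Summit.ResolutionOfSingularities.ResolutionOfSingularities.Theorems.RadicialJung.CleanModels

end
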